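import Mathlib
import Summits.NavierStokesRegularity.NavierStokesRegularity.Theorems.FilamentSkeletonRssStadiumVerticalLinearAbs
import Summits.NavierStokesRegularity.NavierStokesRegularity.Theorems.FilamentSkeletonRssStadiumDeviationReflect
import Summits.NavierStokesRegularity.NavierStokesRegularity.Theorems.FilamentSkeletonRssStadiumOwnFarKernel

/-!
# The sharp own-filament far kernel at a real source — BOTH SIGNS of the target height (`TangentSkeletonNearStraightL`,
# stmt-NavierStokesRegularity-23320, registered stub `stub_stripPropagation`)

Theorems.StadiumOwnFarSharp for `|y|`: 8-fold discs at the target foot (`8|y| < hs`, `|x − cc| + 8|y| < L + hs`), chord `d ≥ 3|y|` ⇒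
`Re(base) ≥ d²/3` and `‖kernel‖ ≤ (d²/3)^{−3/2}·2(d + 2|y|)` (`own_far_pointwise_abs`), via Theorems.StadiumVerticalLinearAbs and
Theorems.StadiumDeviationReflect.  This is the pointwise input of blueprint item R3 (own far piece, holomorphic on the whole thinner stadium).
HONEST FRAMING: a tool for a HYPOTHETICAL filament skeleton on the NEGATIVE side of a MODEL route; nothing here bears on Navier–Stokes regularity
or blow-up.  `--supports stmt-NavierStokesRegularity-23320`.
-/

set_option linter.dupNamespace false

noncomputable section

namespace Summit.NavierStokesRegularity.NavierStokesRegularity.Theorems.StadiumOwnFarAbs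

open Set Metric
open scoped InnerProductSpace Matrix
open Summit.NavierStokesRegularity.NavierStokesRegularity.Theorems.StadiumVerticalDisplacement
open Summit.NavierStokesRegularity.NavierStokesRegularity.Theorems.StadiumKernelPieces
open Summit.NavierStokesRegularity.NavierStokesRegularity.Theorems.StadiumTangentModulus
open Summit.NavierStokesRegularity.NavierStokesRegularity.Theorems.StadiumDeviationPackage
open Summit.NavierStokesRegularity.NavierStokesRegularity.Theorems.StadiumDeviationRatio
open Summit.NavierStokesRegularity.NavierStokesRegularity.Theorems.StadiumVerticalLinear
open Summit.NavierStokesRegularity.NavierStokesRegularity.Theorems.StadiumVerticalLinearAbs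
open Summit.NavierStokesRegularity.NavierStokesRegularity.Theorems.StadiumDeviationReflect
open Summit.NavierStokesRegularity.NavierStokesRegularity.Theorems.StadiumOwnFarKernel

/-- **Sharp own-filament far kernel at a real source, any sign of the height.** [folklore] -/
theorem own_far_pointwise_abs {hs L cc κ : ℝ} {F : ℂ → (Fin 3 → ℂ)}
    (hF : DifferentiableOn ℂ F {z : ℂ | |z.im| < hs ∧ |z.re - cc| < L + hs})
    (hM : ∀ z ∈ {z : ℂ | |z.im| < hs ∧ |z.re - cc| < L + hs}, ‖deriv F z‖ ≤ 2)
    {X : ℝ → EuclideanSpace ℝ (Fin 3)} (hX : Differentiable ℝ X) (hXu : ∀ τ, ‖deriv X τ‖ = 1)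
    (hFX : ∀ r : ℝ, (r : ℂ) ∈ {z : ℂ | |z.im| < hs ∧ |z.re - cc| < L + hs} →
      F r = fun i => ((⟪X r, EuclideanSpace.single i (1:ℝ)⟫_ℝ : ℝ) : ℂ))
    {A : ℝ} (hκA : 0 ≤ κ * A) {x y : ℝ} (hfit : 8 * |y| < hs) (hfit' : |x - cc| + 8 * |y| < L + hs) (σ : ℝ)
    (hdpos : 0 < ‖X x - X σ‖) (hfar : 3 * |y| ≤ ‖X x - X σ‖) :
    ‖X x - X σ‖ ^ 2 / 3 ≤ ((∑ i, (F ((x : ℂ) + (y : ℂ) * Complex.I) i - ((X σ i : ℝ) : ℂ)) ^ 2) + ((κ * A : ℝ) : ℂ)).re ∧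
    ‖(((∑ i, (F ((x : ℂ) + (y : ℂ) * Complex.I) i - ((X σ i : ℝ) : ℂ)) ^ 2) + ((κ * A : ℝ) : ℂ)) ^ ((3:ℂ) / 2))⁻¹ •
        ((fun i => ((deriv X σ i : ℝ) : ℂ)) ⨯₃ (fun i => F ((x : ℂ) + (y : ℂ) * Complex.I) i - ((X σ i : ℝ) : ℂ)))‖ ≤
      (‖X x - X σ‖ ^ 2 / 3) ^ (-(3/2 : ℝ)) * (2 * (‖X x - X σ‖ + 2 * |y|)) := by
  set S : Set ℂ := {z : ℂ | |z.im| < hs ∧ |z.re - cc| < L + hs} with hS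
  have hSo : IsOpen S := by
    have h1 : IsOpen {z : ℂ | |z.im| < hs} := isOpen_lt (continuous_abs.comp Complex.continuous_im) continuous_const
    have h2 : IsOpen {z : ℂ | |z.re - cc| < L + hs} :=
      isOpen_lt (continuous_abs.comp (Complex.continuous_re.sub continuous_const)) continuous_const
    exact h1.inter h2
  set d : ℝ := ‖X x - X σ‖ with hd
  set z : ℂ := (x : ℂ) + (y : ℂ) * Complex.I with hz
  have hy0 : 0 ≤ |y| := abs_nonneg _
  have hhs : 0 < hs := by linarith
  have hxcc : |x - cc| < L + hs := by linarith
  -- the vertical segment lies in `S`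
  have habs_t : ∀ t ∈ Set.uIcc 0 y, |t| ≤ |y| := by
    intro t ht
    rcases le_total 0 y with hu | hu
    · rw [uIcc_of_le hu] at ht
      rw [abs_of_nonneg ht.1, abs_of_nonneg hu]; exact ht.2
    · rw [uIcc_of_ge hu] at ht
      rw [abs_of_nonpos ht.2, abs_of_nonpos hu]; linarith [ht.1]
  have hmem : ∀ t ∈ Set.uIcc 0 y, (x : ℂ) + (t : ℂ) * Complex.I ∈ S := by
    intro t ht
    refine ⟨?_, by simpa using hxcc⟩
    have : (((x : ℂ) + (t : ℂ) * Complex.I).im) = t := by simp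
    rw [this]; linarith [habs_t t ht]
  have hzS : z ∈ S := hmem y Set.right_mem_uIcc
  -- deviation along the segment (ratio 8 at each height)
  have hdev : ∀ t ∈ Set.uIcc 0 y, ‖deriv F ((x : ℂ) + (t : ℂ) * Complex.I) - deriv F (x : ℂ)‖ ≤ 2 * Real.log (8 / (8 - 1)) := by
    intro t ht
    have h8 : 8 * |t| < hs := by linarith [habs_t t ht]
    have h8' : |x - cc| + 8 * |t| < L + hs := by linarith [habs_t t ht]
    exact (deviation_ratio_abs hF hM hFX (by norm_num : (1:ℝ) < 8) h8 h8' hhs hxcc 0).1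
  have hlog : Real.log (8 / (8 - 1)) ≤ 1 / 7 := by
    have h := log_ratio_le (show (1:ℝ) < 8 by norm_num); norm_num at h ⊢; exact h
  set β₁ : ℝ := 2 * Real.log (8 / (8 - 1)) with hβ₁
  have hβ₁le : β₁ ≤ 2 / 7 := by rw [hβ₁]; linarith
  have hβ₁0 : 0 ≤ β₁ := (norm_nonneg _).trans (hdev 0 Set.left_mem_uIcc)
  -- the linear part is `iy • cplx X′(x)`
  set b : Fin 3 → ℂ := F z - F (x : ℂ) - ((y : ℂ) * Complex.I) • deriv F (x : ℂ) with hb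
  have hbn : ‖b‖ ≤ β₁ * |y| := vertical_sub_linear_norm_le_abs hSo hF hmem hdev
  have hbi : ∀ i, ‖b i‖ ≤ β₁ * |y| := fun i => (norm_le_pi_norm b i).trans hbn
  have hFx : F (x : ℂ) = fun i => ((X x i : ℝ) : ℂ) := by
    have hxS : ((x : ℝ) : ℂ) ∈ S := ⟨by simpa using hhs, by simpa using hxcc⟩
    rw [hFX _ hxS]; funext i; rw [inner_single_eq]
  have hF'x : ∀ i, deriv F (x : ℂ) i = ((deriv X x i : ℝ) : ℂ) := by
    intro i
    have h := deriv_real_point hF hX hFX hhs hxcc i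
    rw [inner_single_eq] at h
    apply Complex.ext
    · rw [h.1]; simp
    · rw [h.2]; simp
  -- decomposition `F z − X σ = u + iy T + b`
  set u : EuclideanSpace ℝ (Fin 3) := X x - X σ with hu
  set T : EuclideanSpace ℝ (Fin 3) := deriv X x with hT
  have hdecomp : (fun i => F z i - ((X σ i : ℝ) : ℂ)) =
      fun i => ((u i : ℝ) : ℂ) + ((y : ℂ) * Complex.I) * ((T i : ℝ) : ℂ) + b i := by
    funext i
    have hbi' : b i = F z i - F (x : ℂ) i - ((y : ℂ) * Complex.I) * deriv F (x : ℂ) i := by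
      simp [hb, Pi.sub_apply, Pi.smul_apply, smul_eq_mul]
    rw [hbi', hF'x i]
    have hFxi : F (x : ℂ) i = ((X x i : ℝ) : ℂ) := by rw [hFx]
    rw [hFxi]
    simp only [hu, hT, PiLp.sub_apply, Complex.ofReal_sub]
    ring
  have hsum : (∑ i, (F z i - ((X σ i : ℝ) : ℂ)) ^ 2) = ∑ i, (((u i : ℝ) : ℂ) + ((y : ℂ) * Complex.I) * ((T i : ℝ) : ℂ) + b i) ^ 2 :=
    Finset.sum_congr rfl fun i _ => by rw [congrFun hdecomp i]
  -- (1) real part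
  have hTu : ‖T‖ = 1 := hXu x
  have hre0 := re_sum_sq_vertical_linear_ge u T hTu y b hbi
  have h3 := sqrt_three_le
  have hre1 : d ^ 2 / 3 ≤ (∑ i, (F z i - ((X σ i : ℝ) : ℂ)) ^ 2).re := by
    rw [hsum]
    -- ‖u‖ = d
    have hud : ‖u‖ = d := rfl
    rw [hud] at hre0
    have hyy : y ^ 2 = |y| ^ 2 := (sq_abs y).symm
    rw [hyy] at hre0
    have hβy : β₁ * |y| ≤ 2 / 7 * |y| := mul_le_mul_of_nonneg_right hβ₁le hy0
    have k1 : 2 * √3 * (β₁ * |y|) * (d + |y|) ≤ 2 * (7 / 4) * (2 / 7 * |y|) * (d + |y|) := by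
      have h0 : 0 ≤ d + |y| := by positivity
      have h1 : 2 * √3 * (β₁ * |y|) ≤ 2 * (7 / 4) * (2 / 7 * |y|) :=
        mul_le_mul (mul_le_mul_of_nonneg_left h3 (by norm_num)) hβy (by positivity) (by positivity)
      exact mul_le_mul_of_nonneg_right h1 h0
    have k2 : 3 * (β₁ * |y|) ^ 2 ≤ 3 * (2 / 7 * |y|) ^ 2 := by
      have := pow_le_pow_left₀ (by positivity) hβy 2
      linarith
    nlinarith [hre0, k1, k2, hfar, hy0, hdpos]
  have hbase_re : ((∑ i, (F z i - ((X σ i : ℝ) : ℂ)) ^ 2) + ((κ * A : ℝ) : ℂ)).re =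
      (∑ i, (F z i - ((X σ i : ℝ) : ℂ)) ^ 2).re + κ * A := by
    rw [Complex.add_re, Complex.ofReal_re]
  have hre2 : d ^ 2 / 3 ≤ ((∑ i, (F z i - ((X σ i : ℝ) : ℂ)) ^ 2) + ((κ * A : ℝ) : ℂ)).re := by
    rw [hbase_re]; linarith
  refine ⟨hre2, ?_⟩
  -- (2) kernel norm
  set w : ℂ := (∑ i, (F z i - ((X σ i : ℝ) : ℂ)) ^ 2) + ((κ * A : ℝ) : ℂ) with hw
  have hm0 : 0 < d ^ 2 / 3 := by positivity
  have hwpos : 0 < w.re := lt_of_lt_of_le hm0 hre2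
  have hker : ‖(w ^ ((3:ℂ) / 2))⁻¹‖ ≤ (d ^ 2 / 3) ^ (-(3/2 : ℝ)) :=
    (norm_inv_cpow_threeHalves_le hwpos).trans (Real.rpow_le_rpow_of_nonpos hm0 hre2 (by norm_num))
  have ht : ‖(fun i => ((deriv X σ i : ℝ) : ℂ))‖ ≤ 1 := by
    have h := norm_cplx_le (deriv X σ)
    have e1 : (fun i => ((⟪deriv X σ, EuclideanSpace.single i (1:ℝ)⟫_ℝ : ℝ) : ℂ)) = fun i => ((deriv X σ i : ℝ) : ℂ) := by
      funext i; rw [inner_single_eq]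
    rw [e1, hXu σ] at h
    exact h
  have hseg : ∀ t ∈ Set.uIcc 0 y, (x : ℂ) + (t : ℂ) * Complex.I ∈ S := hmem
  have hv : ‖(fun i => F z i - ((X σ i : ℝ) : ℂ))‖ ≤ d + 2 * |y| := by
    have hsplit : (fun i => F z i - ((X σ i : ℝ) : ℂ)) =
        (fun i => (((X x - X σ) i : ℝ) : ℂ)) + (F z - F (x : ℂ)) := by
      funext i
      simp only [Pi.add_apply, Pi.sub_apply, hFx, PiLp.sub_apply, Complex.ofReal_sub]
      ring
    rw [hsplit]
    have h1 : ‖(fun i => (((X x - X σ) i : ℝ) : ℂ))‖ ≤ d := by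
      have h := norm_cplx_le (X x - X σ)
      have e1 : (fun i => ((⟪X x - X σ, EuclideanSpace.single i (1:ℝ)⟫_ℝ : ℝ) : ℂ)) =
          fun i => (((X x - X σ) i : ℝ) : ℂ) := by
        funext i; rw [inner_single_eq]
      rw [e1] at h
      exact h
    have h2 : ‖F z - F (x : ℂ)‖ ≤ 2 * |y| := norm_sub_le_of_vertical_segment hSo hF hM hseg
    exact (norm_add_le _ _).trans (add_le_add h1 h2)
  have hnum : ‖(fun i => ((deriv X σ i : ℝ) : ℂ)) ⨯₃ (fun i => F z i - ((X σ i : ℝ) : ℂ))‖ ≤ 2 * (d + 2 * |y|) := by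
    have h := norm_crossProduct_le (fun i => ((deriv X σ i : ℝ) : ℂ)) (fun i => F z i - ((X σ i : ℝ) : ℂ))
    calc _ ≤ 2 * ‖(fun i => ((deriv X σ i : ℝ) : ℂ))‖ * ‖(fun i => F z i - ((X σ i : ℝ) : ℂ))‖ := h
      _ ≤ 2 * 1 * (d + 2 * |y|) := by
          apply mul_le_mul (mul_le_mul_of_nonneg_left ht (by norm_num)) hv (norm_nonneg _) (by norm_num)
      _ = 2 * (d + 2 * |y|) := by ring
  rw [norm_smul]
  exact mul_le_mul hker hnum (norm_nonneg _) (Real.rpow_nonneg hm0.le _)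

end Summit.NavierStokesRegularity.NavierStokesRegularity.Theorems.StadiumOwnFarAbs

end
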